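import Mathlib
import Literature.AlgebraicGeometry.Resolution.PIndependence

/-!
# `DescentPerfectToAll` (stmt-ResolutionOfSingularities-0549) — lens 4, generation 4:
# ADAPTED EXISTENTIAL TRANSFER (statements; paper proofs in `ADAPTED-TRANSFER-lens4-g4.md`)

Unit `res-B-lens-4-g4` (planner). OURS; nothing here is a statement of any manuscript, nothing here proves
resolution of singularities in characteristic `p`, nothing here decides the crux; counted 0 on LADDER-RESOLUTION:B.

* `frobImage p K` — the subfield generated by `p`-th powers (`= K^p` in characteristic `p`).
* `AbsPIndependent p K B` — `B ⊆ K` is `p`-independent over `K^p` (tree `IsPIndependent` with base `K^p`).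
* `HL` (horizontal lemma, memo §2): for fields `F → E → K` of characteristic `p`, `B ⊆ E` absolutely
  `p`-independent in `K` and `F ⊆ E^p(B)`, a finitely generated `F`-algebra `A` has `E ⊗ A` regular iff
  `K ⊗ A` regular.  Proof on paper: Zariski's mixed Jacobian criterion for ANY `p`-basis
  [Matsumura, CRT, Thm 30.5] — the only non-zero `p`-basis columns are the `B`-columns, identical over `E`
  and over `K` — plus flat descent [Matsumura, CRT, Thm 23.7 (i)].
* `ExistentiallyClosedIn K L` (`K ≼∃ L`), and `absPIndependent_of_existentiallyClosedIn`: `≼∃` extensions are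
  separable (memo §3, Fact).
* `fixedLevel_failure` (memo §5): the level-uniform strengthening of Corollary B is false — witness
  `F = 𝔽_p(s,t) ⊇ F₀ = 𝔽_p(s^p, t) = F^p(t)`, `A = F₀[x,y]/(y^p - t x^p - s^p)`: `A` is a regular one-dimensional
  domain (so it has no proper birational modification other than itself), `F ⊗_{F₀} A = F[x,y]/((y-s)^p - t x^p)` is
  reduced and not regular.

Theorem A itself (memo §3: `K ≼∃ L`, `B` a `p`-basis of `K` ⇒ `Res_K(X) ↔ X_L` has an `L^p(B)`-rational
resolution) and Corollary B (memo §4) are scheme-level and are not typed here.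
Sorries: `HL`, `absPIndependent_of_existentiallyClosedIn`, `fixedLevel_failure` (paper proofs in the memo).
-/

set_option linter.dupNamespace false
set_option linter.unusedVariables false

open scoped TensorProduct

namespace Summit.ResolutionOfSingularities.ResolutionOfSingularities.Cruxes.DescentPerfectToAll.AdaptedTransfer

/-- The subfield of `K` generated by the `p`-th powers (in characteristic `p` this is the image of Frobenius,
`K^p`). -/
def frobImage (p : ℕ) (K : Type) [Field K] : Subfield K :=
  Subfield.closure (Set.range fun x : K => x ^ p)

/-- **Absolute `p`-independence**: `B ⊆ K` is `p`-independent over `K^p` (every finite `t ⊆ B` has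
`[K^p(t) : K^p] = p^{#t}`), in the tree's shape `Literature.AlgebraicGeometry.Resolution.IsPIndependent`. -/
def AbsPIndependent (p : ℕ) (K : Type) [Field K] (B : Set K) : Prop :=
  Literature.AlgebraicGeometry.Resolution.IsPIndependent (F := frobImage p K) p B

/-- **HL (horizontal lemma).**  `F → E → K` fields of characteristic `p`; `B ⊆ E` whose image in `K` is
absolutely `p`-independent; every element of `F` lies in `E^p(B)`.  Then for every finitely generated
`F`-algebra `A`:  `E ⊗_F A` is a regular ring iff `K ⊗_F A` is.  [OURS; memo §2.  Matsumura CRT Thm 30.5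
(Zariski) + Thm 23.7(i).] -/
theorem HL (p : ℕ) [Fact p.Prime]
    (F E K : Type) [Field F] [Field E] [Field K] [CharP F p] [CharP E p] [CharP K p]
    [Algebra F E] [Algebra E K] [Algebra F K] [IsScalarTower F E K]
    (B : Set E) (hB : AbsPIndependent p K (algebraMap E K '' B))
    (hF : ∀ x : F, algebraMap F E x ∈ Subfield.closure (Set.range (fun y : E => y ^ p) ∪ B))
    (A : Type) [CommRing A] [Algebra F A] [Algebra.FiniteType F A] :
    IsRegularRing (E ⊗[F] A) ↔ IsRegularRing (K ⊗[F] A) := by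
  sorry

/-- `K ≼∃ L`: every finite system of polynomial equations and inequations over `K` in finitely many
unknowns that has a solution in `L` has a solution in `K`.  (Examples, memo §3: `K ≼∃ K^U`;
`⋃ₙ Kₙ ≼∃ ∏_U Kₙ`.) -/
def ExistentiallyClosedIn (K L : Type) [Field K] [Field L] [Algebra K L] : Prop :=
  ∀ (m : ℕ) (S T : Finset (MvPolynomial (Fin m) K)),
    (∃ x : Fin m → L, (∀ f ∈ S, MvPolynomial.aeval x f = 0) ∧ ∀ g ∈ T, MvPolynomial.aeval x g ≠ 0) →
      ∃ x : Fin m → K, (∀ f ∈ S, MvPolynomial.eval x f = 0) ∧ ∀ g ∈ T, MvPolynomial.eval x g ≠ 0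

/-- **`≼∃` extensions are separable**: an absolutely `p`-independent subset of `K` stays absolutely
`p`-independent in any `L` with `K ≼∃ L` (a non-trivial `L^p`-relation among `p`-monomials of `B` is an
existential statement over `K`).  [OURS; memo §3, Fact.] -/
theorem absPIndependent_of_existentiallyClosedIn (p : ℕ) [Fact p.Prime]
    (K L : Type) [Field K] [Field L] [CharP K p] [CharP L p] [Algebra K L]
    (h : ExistentiallyClosedIn K L) (B : Set K) (hB : AbsPIndependent p K B) :
    AbsPIndependent p L (algebraMap K L '' B) := by
  sorry

/-- **Fixed-level failure (S⁺ is false, memo §5).**  There are a field `F` of characteristic `p`, a subfield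
`F₀` containing `t` with `F₀ ⊆ F^p(t)` and `{t}` absolutely `p`-independent in `F`, and a finitely generated
`F₀`-algebra `A` which is a regular one-dimensional domain such that `F ⊗_{F₀} A` is reduced but NOT regular.
Witness: `F = 𝔽_p(s,t)`, `F₀ = 𝔽_p(s^p,t)`, `A = F₀[x,y]/(y^p - t·x^p - s^p)` (over `F₀`, `D_{s^p}` of the
equation is `-1`; over `F` the point `(x, y - s)` of `(y-s)^p = t x^p` has Jacobian rank `0`).  Since a regular
curve has no proper birational modification but itself, no `F₀`-rational resolution of `F ⊗ A` exists: the
level-uniform form of Corollary B fails.  [OURS; in-tree companions p536106 `not_oneRootRobustAtFixedLevel`,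
p538259.] -/
theorem fixedLevel_failure (p : ℕ) [Fact p.Prime] :
    ∃ (F : Type) (_ : Field F) (_ : CharP F p) (F₀ : Subfield F) (t : F),
      t ∈ F₀ ∧ AbsPIndependent p F {t} ∧
      (∀ x : F, x ∈ F₀ → x ∈ Subfield.closure (Set.range (fun y : F => y ^ p) ∪ {t})) ∧
      ∃ (A : Type) (_ : CommRing A) (_ : Algebra F₀ A),
        Algebra.FiniteType F₀ A ∧ IsDomain A ∧ IsRegularRing A ∧ ringKrullDim A = 1 ∧
        IsReduced (F ⊗[F₀] A) ∧ ¬ IsRegularRing (F ⊗[F₀] A) := by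
  sorry

end Summit.ResolutionOfSingularities.ResolutionOfSingularities.Cruxes.DescentPerfectToAll.AdaptedTransfer
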